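import Summits.KontsevichZagierPeriods.KontsevichZagierPeriods.Theorems.RootDecompRelativeModAbsoluteCylLogSplitP48
import Summits.KontsevichZagierPeriods.KontsevichZagierPeriods.Theorems.RootDecompRelativeModAbsoluteCircleLogP11
import Literature.NumberTheory.Transcendental.KZFibreMapMove
import Literature.NumberTheory.Transcendental.KZDominatedFamilyRelations
import Literature.NumberTheory.Transcendental.BakerRelationDecomposition
import Literature.NumberTheory.Transcendental.SemialgebraicAlgebraicPoints
import Literature.NumberTheory.Transcendental.KZSemialgebraicComplex
import Literature.NumberTheory.Transcendental.KZCalculusOver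
import Literature.ModelTheory.ExponentialFields.SemialgebraicInterior
import Mathlib.FieldTheory.AlgebraicClosure
import Mathlib.RingTheory.AlgebraicIndependent.Transcendental
import Mathlib.Topology.MetricSpace.Pseudo.Pi
import Literature.ModelTheory.ExponentialFields.CylindricalDecompositionProofs
import Literature.NumberTheory.Transcendental.SemialgebraicLineDeriv
import Literature.NumberTheory.Transcendental.KZTorusLogRep
import Summits.KontsevichZagierPeriods.KontsevichZagierPeriods.Theorems.LiouvilleUnfoldingLogPrimitiveNLStubDescent
import Summits.KontsevichZagierPeriods.KontsevichZagierPeriods.Theorems.LiouvilleUnfoldingLogPrimitiveNLStubPeelingStep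
import Summits.KontsevichZagierPeriods.KontsevichZagierPeriods.Theorems.LiouvilleUnfoldingLogPrimitiveNLStubConstRigidity
import Mathlib.Analysis.SpecialFunctions.Log.Deriv
import Mathlib.Analysis.SpecialFunctions.Trigonometric.ArctanDeriv
import Mathlib.Algebra.BigOperators.Fin

/-! # `RootDecompRelativeModAbsoluteCircleSplitP01` — part 1/12 of the mechanical ≤400-line split of `csk_min.lean` (sha256 066c56c743abe73e…)
Source: decomp-kz lens-3 g14 CircleSplitK.lean @3d3b9378 (= CircleSplit @d1112051 §0–§25 + §26 kernel split + §27 odd→log; critic CLEARED g6-21 l.1371, g7-2 l.1388) minus the 65 declarations already landed in …CircleLogP1–P11 / …CylLogSplitP46–P49 and minus the 20 superseded g13-glue/tame-class lemmas not on the §26–§27 chain; imports …CylLogSplitP48 + …CircleLogP11; --supports stmt-KontsevichZagierPeriods-30572.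
Split by census-1 g10 `gen/splitlean.py`: scopes re-opened with their `open`/`variable`/`set_option` context; mathematics and declaration order unchanged. -/

/-! # g14 — the CIRCLE TWIN of the landed log chain beneath the residual `CylKernelZeroCirclePos`, WITH THE DESCENT LOOP

(decomp-kz lens-3, generation 14; work file = generation-13 `CircleSplit.lean` (§0–§23, unchanged) + §24 THE DESCENT LOOP
(`circleLogStructureAt_one : CircleLogStructureAt 1`, `circleLogStructureMovingCirc_holds : CircleLogStructureMovingCirc` — PROVED,
0 sorry, standard axioms) + §25 the g14 node `cylKernelZeroCirclePos_of_logFold_angleFold_wild :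
LogCellwiseFoldAt 1 → AngleCellwiseFoldAt 1 → CellCloseCSWild → CylKernelZeroCirclePos`; elaborated against the tree @ the landed
`…CylLogSplitP25`).  The landable standalone part (§4 defs + §8–§10 + §12 + §14–§24) is `CircleDescent.lean` next to this file.

See `NODE-g14.md` next to this file for the node, the tags and the «why novel / why weaker» sentences. -/

noncomputable section
open Set MeasureTheory Filter Topology
open scoped BigOperators
open Literature.NumberTheory.Transcendental Literature.ModelTheory.ExponentialFields

/-! ## §0 The target, restated VERBATIM (token-identical copy of
`…RegularisedLogLayer.CylLog.Leaf.CylKernelZeroCirclePos`, RungClosure.lean (v9 @f909f334) l.6151 — that file is not yet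
landed, so the definition is carried here; DROP THIS COPY when RungClosure v9 lands). -/

namespace Summit.KontsevichZagierPeriods.RootDecompRelativeModAbsolute.Rung30571.RegularisedLogLayer.CylLog.Leaf

namespace G13

/-! ## §1 The `e = 2` fibre integral `∫₀¹ θ^M/(1+θ²κ) dθ`: positivity, continuity in `κ`, and the CLOSED FORM
(recursion `I_{M+2} = (1/(M+1) − I_M)/κ`, bases `I₀ = arctan √κ/√κ`, `I₁ = log(1+κ)/(2κ)`) — PROVED -/

/-- The kernel denominator is positive on the closed fibre for `κ > −1` (any exponent `e`). -/
theorem den_pos (e : ℕ) {κ : ℝ} (hκ : -1 < κ) {θ : ℝ} (hθ : θ ∈ Icc (0:ℝ) 1) : 0 < 1 + θ ^ e * κ := by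
  have h0 : 0 ≤ θ ^ e := pow_nonneg hθ.1 e
  have h1 : θ ^ e ≤ 1 := pow_le_one₀ hθ.1 hθ.2
  rcases le_or_gt 0 κ with hk | hk
  · nlinarith
  · nlinarith

/-- Continuity of the kernel on the closed fibre. -/
theorem continuousOn_kernelE (M e : ℕ) {κ : ℝ} (hκ : -1 < κ) :
    ContinuousOn (fun θ : ℝ => θ ^ M / (1 + θ ^ e * κ)) (Icc 0 1) :=
  ContinuousOn.div (continuousOn_id.pow M) (continuousOn_const.add ((continuousOn_id.pow e).mul continuousOn_const))
    fun _ hθ => (den_pos e hκ hθ).ne'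

/-- Integrability of the kernel on the open fibre. -/
theorem integrableOn_kernelE (M e : ℕ) {κ : ℝ} (hκ : -1 < κ) :
    IntegrableOn (fun θ : ℝ => θ ^ M / (1 + θ ^ e * κ)) (Ioo 0 1) :=
  ((continuousOn_kernelE M e hκ).integrableOn_compact isCompact_Icc).mono_set Ioo_subset_Icc_self

/-- The fibre integral `κ ↦ ∫₀¹ θ^M/(1+θ^e κ) dθ` is continuous on `(−1, ∞)` (dominated convergence; twin of §3y). -/
theorem continuousOn_fibreIntegralE (M e : ℕ) :
    ContinuousOn (fun κ : ℝ => ∫ θ in Set.Ioo (0:ℝ) 1, θ ^ M / (1 + θ ^ e * κ)) (Set.Ioi (-1)) := by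
  intro κ₀ hκ₀
  refine ContinuousAt.continuousWithinAt ?_
  have hκ₀' : (-1 : ℝ) < κ₀ := hκ₀
  set κ₁ : ℝ := (κ₀ - 1) / 2 with hκ₁
  have hκ₁0 : -1 < κ₁ := by rw [hκ₁]; linarith
  have hκ₁1 : κ₁ < κ₀ := by rw [hκ₁]; linarith
  set c₀ : ℝ := min 1 (1 + κ₁) with hc₀
  have hc₀pos : 0 < c₀ := lt_min one_pos (by linarith)
  have hden : ∀ κ, κ₁ < κ → ∀ θ ∈ Set.Ioo (0:ℝ) 1, c₀ ≤ 1 + θ ^ e * κ := by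
    intro κ hκ θ hθ
    have h0 : 0 ≤ θ ^ e := pow_nonneg hθ.1.le e
    have h1' : θ ^ e ≤ 1 := pow_le_one₀ hθ.1.le hθ.2.le
    have h1 : θ ^ e * κ₁ ≤ θ ^ e * κ := by nlinarith
    rcases le_or_gt 0 κ₁ with hk | hk
    · calc c₀ ≤ 1 := min_le_left _ _
        _ ≤ 1 + θ ^ e * κ := by nlinarith
    · calc c₀ ≤ 1 + κ₁ := min_le_right _ _
        _ ≤ 1 + θ ^ e * κ₁ := by nlinarith
        _ ≤ 1 + θ ^ e * κ := by linarith
  have hpos : ∀ κ, κ₁ < κ → ∀ θ ∈ Set.Ioo (0:ℝ) 1, 0 < 1 + θ ^ e * κ := fun κ hκ θ hθ =>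
    lt_of_lt_of_le hc₀pos (hden κ hκ θ hθ)
  have hnhds : ∀ᶠ κ in 𝓝 κ₀, κ₁ < κ := Ioi_mem_nhds hκ₁1
  haveI : IsFiniteMeasure (volume.restrict (Set.Ioo (0:ℝ) 1)) :=
    ⟨by rw [Measure.restrict_apply_univ]; exact measure_Ioo_lt_top⟩
  refine MeasureTheory.continuousAt_of_dominated (bound := fun _ => 1 / c₀) ?_ ?_ (integrable_const _) ?_
  · filter_upwards [hnhds] with κ hκ
    have hc : ContinuousOn (fun θ : ℝ => θ ^ M / (1 + θ ^ e * κ)) (Set.Ioo 0 1) :=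
      ContinuousOn.div (continuousOn_id.pow M)
        (continuousOn_const.add ((continuousOn_id.pow e).mul continuousOn_const)) fun θ hθ => (hpos κ hκ θ hθ).ne'
    exact hc.aestronglyMeasurable measurableSet_Ioo
  · filter_upwards [hnhds] with κ hκ
    refine ae_restrict_of_forall_mem measurableSet_Ioo fun θ hθ => ?_
    rw [norm_div, norm_pow, Real.norm_eq_abs, Real.norm_eq_abs, abs_of_pos hθ.1, abs_of_pos (hpos κ hκ θ hθ)]
    calc θ ^ M / (1 + θ ^ e * κ) ≤ 1 / (1 + θ ^ e * κ) := by
          gcongr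
          · exact (hpos κ hκ θ hθ).le
          · exact pow_le_one₀ hθ.1.le hθ.2.le
      _ ≤ 1 / c₀ := one_div_le_one_div_of_le hc₀pos (hden κ hκ θ hθ)
  · refine ae_restrict_of_forall_mem measurableSet_Ioo fun θ hθ => ?_
    have hne : 1 + θ ^ e * κ₀ ≠ 0 := (hpos κ₀ hκ₁1 θ hθ).ne'
    exact continuousAt_const.div (continuousAt_const.add (continuousAt_const.mul continuousAt_id)) hne

/-- Composite form: `x ↦ c x · ∫₀¹ θ^M/(1+θ^e κ(x)) dθ` is continuous on a cell where `c, κ` are continuous, `κ > −1`. -/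
theorem continuousOn_coeff_mul_fibreIntegralE {b M e : ℕ} {C : Set (Fin b → ℝ)} {c κ : (Fin b → ℝ) → ℝ}
    (hc : ContinuousOn c C) (hκ : ContinuousOn κ C) (hκ1 : ∀ x ∈ C, -1 < κ x) :
    ContinuousOn (fun x => c x * ∫ θ in Set.Ioo (0:ℝ) 1, θ ^ M / (1 + θ ^ e * κ x)) C :=
  hc.mul ((continuousOn_fibreIntegralE M e).comp hκ fun x hx => hκ1 x hx)

/-- `∫₀¹ θ^M dθ = 1/(M+1)` on the open fibre. -/
theorem integral_pow_Ioo (M : ℕ) : ∫ θ in Set.Ioo (0:ℝ) 1, θ ^ M = 1 / ((M : ℝ) + 1) := by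
  rw [← integral_Ioc_eq_integral_Ioo, ← intervalIntegral.integral_of_le zero_le_one, integral_pow]
  simp

/-- **The recursion** `I_{M+2}(κ) = (1/(M+1) − I_M(κ))/κ` (`κ ≠ 0`, `κ > −1`). -/
theorem fibreIntegralSq_succ_succ (M : ℕ) {κ : ℝ} (hκ : κ ≠ 0) (hκ1 : -1 < κ) :
    ∫ θ in Set.Ioo (0:ℝ) 1, θ ^ (M + 2) / (1 + θ ^ 2 * κ) =
      (1 / ((M : ℝ) + 1) - ∫ θ in Set.Ioo (0:ℝ) 1, θ ^ M / (1 + θ ^ 2 * κ)) / κ := by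
  have h1 : ∫ θ in Set.Ioo (0:ℝ) 1, θ ^ (M + 2) / (1 + θ ^ 2 * κ) =
      ∫ θ in Set.Ioo (0:ℝ) 1, (θ ^ M - θ ^ M / (1 + θ ^ 2 * κ)) / κ := by
    refine setIntegral_congr_fun measurableSet_Ioo fun θ hθ => ?_
    have hd : 1 + θ ^ 2 * κ ≠ 0 := (den_pos 2 hκ1 ⟨hθ.1.le, hθ.2.le⟩).ne'
    field_simp
    ring
  rw [h1, integral_div, integral_sub _ (integrableOn_kernelE M 2 hκ1), integral_pow_Ioo]
  exact (continuousOn_id.pow M).integrableOn_compact isCompact_Icc |>.mono_set Ioo_subset_Icc_self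

/-- **Base `M = 0`**: `∫₀¹ dθ/(1+θ²κ) = arctan(√κ)/√κ` (`κ > 0`). -/
theorem fibreIntegralSq_zero {κ : ℝ} (hκ : 0 < κ) :
    ∫ θ in Set.Ioo (0:ℝ) 1, θ ^ 0 / (1 + θ ^ 2 * κ) = Real.arctan (Real.sqrt κ) / Real.sqrt κ := by
  set w := Real.sqrt κ with hw
  have hw0 : 0 < w := Real.sqrt_pos.mpr hκ
  have hwk : w ^ 2 = κ := Real.sq_sqrt hκ.le
  have h1 : (∫ θ in Set.Ioo (0:ℝ) 1, θ ^ 0 / (1 + θ ^ 2 * κ)) =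
      ∫ θ in (0:ℝ)..1, (fun x : ℝ => (1 + x ^ 2)⁻¹) (θ * w) := by
    rw [intervalIntegral.integral_of_le zero_le_one, integral_Ioc_eq_integral_Ioo]
    refine setIntegral_congr_fun measurableSet_Ioo fun θ _ => ?_
    simp only [pow_zero, mul_pow, one_div, hwk]
  rw [h1, intervalIntegral.integral_comp_mul_right (fun x : ℝ => (1 + x ^ 2)⁻¹) hw0.ne', zero_mul, one_mul,
    integral_inv_one_add_sq, Real.arctan_zero, sub_zero, smul_eq_mul, div_eq_inv_mul]

/-- **Base `M = 1`**: `∫₀¹ θ dθ/(1+θ²κ) = log(1+κ)/(2κ)` (`κ ≠ 0`, `κ > −1`). -/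
theorem fibreIntegralSq_one {κ : ℝ} (hκ : κ ≠ 0) (hκ1 : -1 < κ) :
    ∫ θ in Set.Ioo (0:ℝ) 1, θ ^ 1 / (1 + θ ^ 2 * κ) = Real.log (1 + κ) / (2 * κ) := by
  have hF : ∀ θ ∈ Set.uIcc (0:ℝ) 1,
      HasDerivAt (fun θ : ℝ => Real.log (1 + θ ^ 2 * κ) / (2 * κ)) (θ ^ 1 / (1 + θ ^ 2 * κ)) θ := by
    intro θ hθ
    rw [Set.uIcc_of_le zero_le_one] at hθ
    have hd : 1 + θ ^ 2 * κ ≠ 0 := (den_pos 2 hκ1 hθ).ne'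
    have h1 : HasDerivAt (fun θ : ℝ => 1 + θ ^ 2 * κ) (2 * θ * κ) θ :=
      (((hasDerivAt_pow 2 θ).mul_const κ).const_add 1).congr_deriv (by norm_num)
    have h2 := (h1.log hd).div_const (2 * κ)
    refine h2.congr_deriv ?_
    rw [pow_one]
    field_simp
  have hint : IntervalIntegrable (fun θ : ℝ => θ ^ 1 / (1 + θ ^ 2 * κ)) volume 0 1 :=
    ((continuousOn_kernelE 1 2 hκ1).mono (by rw [Set.uIcc_of_le zero_le_one])).intervalIntegrable
  rw [← integral_Ioc_eq_integral_Ioo, ← intervalIntegral.integral_of_le zero_le_one,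
    intervalIntegral.integral_eq_sub_of_hasDerivAt hF hint]
  simp

/-- Rational part of `∫₀¹ θ^{2j+r}/(1+θ²κ) dθ` (`r ∈ {0,1}`): `R_r(0) = 0`, `R_r(j+1) = (1/(2j+r+1) − R_r(j))/κ`. -/
def sqPoly (r : ℕ) : ℕ → ℝ → ℝ
  | 0, _ => 0
  | j + 1, κ => (1 / (((2 * j + r : ℕ) : ℝ) + 1) - sqPoly r j κ) / κ

/-- Transcendental coefficient of `∫₀¹ θ^{2j+r}/(1+θ²κ) dθ`: `T_r(0) = 1` (`r = 0`) resp. `1/2` (`r = 1`),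
`T_r(j+1) = −T_r(j)/κ`; so `T_r(j) = (−1)^j κ^{−j} T_r(0)`. -/
def sqTrans (r : ℕ) : ℕ → ℝ → ℝ
  | 0, _ => if r = 0 then 1 else 1 / 2
  | j + 1, κ => -sqTrans r j κ / κ

/-- The transcendental of parity `r`: `arctan(√κ)/√κ` (`r = 0`, circle kind) resp. `log(1+κ)/κ` (`r = 1`, log kind). -/
def sqT (r : ℕ) (κ : ℝ) : ℝ :=
  if r = 0 then Real.arctan (Real.sqrt κ) / Real.sqrt κ else Real.log (1 + κ) / κ

/-- **Closed form** of the `e = 2` fibre integral (`κ > 0`), by parity `r` and half-order `j`. -/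
theorem fibreIntegralSq_closed_form (r : ℕ) (hr : r = 0 ∨ r = 1) (j : ℕ) {κ : ℝ} (hκ : 0 < κ) :
    ∫ θ in Set.Ioo (0:ℝ) 1, θ ^ (2 * j + r) / (1 + θ ^ 2 * κ) = sqPoly r j κ + sqTrans r j κ * sqT r κ := by
  induction j with
  | zero =>
    rcases hr with rfl | rfl
    · simp only [Nat.mul_zero, Nat.zero_add, sqPoly, sqTrans, sqT, if_true, fibreIntegralSq_zero hκ]
      ring
    · simp only [Nat.mul_zero, Nat.zero_add, sqPoly, sqTrans, sqT, one_ne_zero, if_false,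
        fibreIntegralSq_one hκ.ne' (by linarith)]
      field_simp
      ring
  | succ j ih =>
    rw [show 2 * (j + 1) + r = (2 * j + r) + 2 by ring, fibreIntegralSq_succ_succ _ hκ.ne' (by linarith), ih]
    simp only [sqPoly, sqTrans]
    push_cast
    field_simp
    ring

/-- Closed form indexed by the order `M` itself (`j = M/2`, `r = M % 2`). -/
theorem fibreIntegralSq_closed_form' (M : ℕ) {κ : ℝ} (hκ : 0 < κ) :
    ∫ θ in Set.Ioo (0:ℝ) 1, θ ^ M / (1 + θ ^ 2 * κ) =
      sqPoly (M % 2) (M / 2) κ + sqTrans (M % 2) (M / 2) κ * sqT (M % 2) κ := by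
  have h := fibreIntegralSq_closed_form (M % 2) (Nat.mod_two_eq_zero_or_one M) (M / 2) hκ
  rwa [Nat.div_add_mod M 2] at h

/-- Semialgebraicity of the rational part along a `ℚ`-sa positive function. -/
theorem isSemialgebraicFunOn_sqPoly {b : ℕ} {C : Set (Fin b → ℝ)} (hC : IsSemialgebraic ℚ C) (r j : ℕ)
    {κ : (Fin b → ℝ) → ℝ} (hκ : IsSemialgebraicFunOn ℚ C κ) (hpos : ∀ x ∈ C, κ x ≠ 0) :
    IsSemialgebraicFunOn ℚ C (fun x => sqPoly r j (κ x)) := by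
  induction j with
  | zero => exact (isSemialgebraicFunOn_ratCast hC 0).congr fun x _ => by simp [sqPoly]
  | succ j ih =>
    have hnum : IsSemialgebraicFunOn ℚ C (fun x => 1 / (((2 * j + r : ℕ) : ℝ) + 1) - sqPoly r j (κ x)) :=
      (IsSemialgebraicFunOn.sub_holds (isSemialgebraicFunOn_ratCast hC (1 / (((2 * j + r : ℕ) : ℚ) + 1))) ih).congr
        fun x _ => by push_cast; rfl
    exact (hnum.div hκ hpos).congr fun x _ => by simp [sqPoly]

/-- Semialgebraicity of the transcendental coefficient along a `ℚ`-sa nonvanishing function. -/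
theorem isSemialgebraicFunOn_sqTrans {b : ℕ} {C : Set (Fin b → ℝ)} (hC : IsSemialgebraic ℚ C) (r j : ℕ)
    {κ : (Fin b → ℝ) → ℝ} (hκ : IsSemialgebraicFunOn ℚ C κ) (hpos : ∀ x ∈ C, κ x ≠ 0) :
    IsSemialgebraicFunOn ℚ C (fun x => sqTrans r j (κ x)) := by
  induction j with
  | zero =>
    by_cases h : r = 0
    · exact (isSemialgebraicFunOn_ratCast hC 1).congr fun x _ => by simp [sqTrans, h]
    · exact (isSemialgebraicFunOn_ratCast hC (1 / 2)).congr fun x _ => by simp [sqTrans, h]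
  | succ j ih => exact (ih.neg.div hκ hpos).congr fun x _ => by simp [sqTrans, neg_div]

/-! ## §2 The per-index CURRENCY CONVERSION on a cell: `cᵢ ∫₀¹ θ^{Mᵢ}/(1+θ^{eᵢ}κᵢ) = cPolyᵢ + cLogᵢ·log(1+κᵢ) +
cAtanᵢ·arctan(atanArgᵢ)` — the log kind (`eᵢ = 1`) is the landed §3z (`polyPart`/`logCoef`), the circle kind (`eᵢ = 2`,
`κᵢ > 0`) is §1: odd order ⇒ log kind (`log(1+κᵢ)`), even order ⇒ circle kind (`arctan √κᵢ`) — PROVED -/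

variable {b : ℕ}

/-- Polynomial (`ℚ`-sa) part of index `i`. -/
def cPoly {b q : ℕ} (e : Fin q → ℕ) (s : Fin q → Bool) (c κ : Fin q → (Fin b → ℝ) → ℝ) (M : Fin q → ℕ)
    (i : Fin q) (x : Fin b → ℝ) : ℝ :=
  if e i = 2 then c i x * sqPoly (M i % 2) (M i / 2) (κ i x) else polyPart s c κ M i x

/-- Coefficient of `log (1+κᵢ)` of index `i`. -/
def cLog {b q : ℕ} (e : Fin q → ℕ) (s : Fin q → Bool) (c κ : Fin q → (Fin b → ℝ) → ℝ) (M : Fin q → ℕ)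
    (i : Fin q) (x : Fin b → ℝ) : ℝ :=
  if e i = 2 then (if M i % 2 = 1 then c i x * sqTrans 1 (M i / 2) (κ i x) / κ i x else 0)
  else logCoef s c κ M i x

/-- Coefficient of `arctan √κᵢ` of index `i` (zero unless `eᵢ = 2` and `Mᵢ` is even). -/
def cAtan {b q : ℕ} (e : Fin q → ℕ) (c κ : Fin q → (Fin b → ℝ) → ℝ) (M : Fin q → ℕ)
    (i : Fin q) (x : Fin b → ℝ) : ℝ :=
  if e i = 2 ∧ M i % 2 = 0 then c i x * sqTrans 0 (M i / 2) (κ i x) / Real.sqrt (κ i x) else 0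

/-- The arctangent argument of index `i`: `√κᵢ` for the circle kind, `0` otherwise. -/
def atanArg {b q : ℕ} (e : Fin q → ℕ) (κ : Fin q → (Fin b → ℝ) → ℝ) (i : Fin q) (x : Fin b → ℝ) : ℝ :=
  if e i = 2 then Real.sqrt (κ i x) else 0

/-- **Per-index conversion** (both kinds). -/
theorem term_eqC {b q : ℕ} (e : Fin q → ℕ) (s : Fin q → Bool) (c κ : Fin q → (Fin b → ℝ) → ℝ)
    (M : Fin q → ℕ) {C : Set (Fin b → ℝ)} (he : ∀ i, e i = 1 ∨ e i = 2)
    (hs : ∀ i, s i = true → ∀ x ∈ C, κ i x ≠ 0) (hs' : ∀ i, s i = false → ∀ x ∈ C, κ i x = 0)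
    (hκ1 : ∀ i, ∀ x ∈ C, -1 < κ i x) (hpos : ∀ i, e i = 2 → ∀ x ∈ C, 0 < κ i x) (i : Fin q)
    {x : Fin b → ℝ} (hx : x ∈ C) :
    c i x * ∫ θ in Set.Ioo (0:ℝ) 1, θ ^ M i / (1 + θ ^ e i * κ i x) =
      cPoly e s c κ M i x + cLog e s c κ M i x * Real.log (1 + κ i x) +
        cAtan e c κ M i x * Real.arctan (atanArg e κ i x) := by
  rcases he i with h1 | h2
  · have h12 : ¬ e i = 2 := by omega
    simp only [cPoly, cLog, cAtan, atanArg, h12, if_false, false_and, Real.arctan_zero, mul_zero, add_zero]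
    rw [h1]
    simp only [pow_one]
    exact term_eq_polyPart_add_logCoef s c κ M hs hs' hκ1 i hx
  · have hk := hpos i h2 x hx
    have hsq : 0 < Real.sqrt (κ i x) := Real.sqrt_pos.mpr hk
    rw [h2, fibreIntegralSq_closed_form' (M i) hk]
    rcases Nat.mod_two_eq_zero_or_one (M i) with h0 | h1
    · have hc' : (e i = 2 ∧ M i % 2 = 0) := ⟨h2, h0⟩
      simp only [cPoly, cLog, cAtan, atanArg, sqT, h2, h0, if_true, zero_ne_one, if_false, zero_mul, add_zero,
        and_self]
      field_simp
    · simp only [cPoly, cLog, cAtan, atanArg, sqT, h2, h1, if_true, one_ne_zero, if_false, and_false, zero_mul,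
        add_zero]
      field_simp

/-- **Integral identity ⇒ joint log/arctangent identity** on a cell with fixed signs. -/
theorem circForm_of_integralForm {b q : ℕ} {C : Set (Fin b → ℝ)} (e : Fin q → ℕ) (s : Fin q → Bool)
    {a₀ : (Fin b → ℝ) → ℝ} {c κ : Fin q → (Fin b → ℝ) → ℝ} {M : Fin q → ℕ} (he : ∀ i, e i = 1 ∨ e i = 2)
    (hs : ∀ i, s i = true → ∀ x ∈ C, κ i x ≠ 0) (hs' : ∀ i, s i = false → ∀ x ∈ C, κ i x = 0)
    (hκ1 : ∀ i, ∀ x ∈ C, -1 < κ i x) (hpos : ∀ i, e i = 2 → ∀ x ∈ C, 0 < κ i x)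
    (hid : ∀ x ∈ C, a₀ x + ∑ i, c i x * ∫ θ in Set.Ioo (0:ℝ) 1, θ ^ M i / (1 + θ ^ e i * κ i x) = 0) :
    ∀ x ∈ C, ∑ i, cLog e s c κ M i x * Real.log (1 + κ i x) +
      ∑ i, cAtan e c κ M i x * Real.arctan (atanArg e κ i x) = -(a₀ x + ∑ i, cPoly e s c κ M i x) := by
  intro x hx
  have h := hid x hx
  rw [Finset.sum_congr rfl fun i _ => term_eqC e s c κ M he hs hs' hκ1 hpos i hx, Finset.sum_add_distrib,
    Finset.sum_add_distrib] at h
  linarith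

/-- Auxiliary step `isSemialgebraicFunOn_cPoly`. [bookkeeping] -/
theorem isSemialgebraicFunOn_cPoly {b q : ℕ} {C : Set (Fin b → ℝ)} (hC : IsSemialgebraic ℚ C) (e : Fin q → ℕ)
    (s : Fin q → Bool) {c κ : Fin q → (Fin b → ℝ) → ℝ} (M : Fin q → ℕ)
    (hc : ∀ i, IsSemialgebraicFunOn ℚ C (c i)) (hκ : ∀ i, IsSemialgebraicFunOn ℚ C (κ i))
    (hs : ∀ i, s i = true → ∀ x ∈ C, κ i x ≠ 0) (hpos : ∀ i, e i = 2 → ∀ x ∈ C, 0 < κ i x) (i : Fin q) :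
    IsSemialgebraicFunOn ℚ C (cPoly e s c κ M i) := by
  by_cases h : e i = 2
  · exact (IsSemialgebraicFunOn.mul_holds (hc i) (isSemialgebraicFunOn_sqPoly hC (M i % 2) (M i / 2) (hκ i)
      fun x hx => (hpos i h x hx).ne')).congr fun x _ => by simp [cPoly, h]
  · exact (isSemialgebraicFunOn_polyPart hC s M hc hκ hs i).congr fun x _ => by simp [cPoly, h]

/-- Auxiliary step `isSemialgebraicFunOn_cLog`. [bookkeeping] -/
theorem isSemialgebraicFunOn_cLog {b q : ℕ} {C : Set (Fin b → ℝ)} (hC : IsSemialgebraic ℚ C) (e : Fin q → ℕ)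
    (s : Fin q → Bool) {c κ : Fin q → (Fin b → ℝ) → ℝ} (M : Fin q → ℕ)
    (hc : ∀ i, IsSemialgebraicFunOn ℚ C (c i)) (hκ : ∀ i, IsSemialgebraicFunOn ℚ C (κ i))
    (hs : ∀ i, s i = true → ∀ x ∈ C, κ i x ≠ 0) (hpos : ∀ i, e i = 2 → ∀ x ∈ C, 0 < κ i x) (i : Fin q) :
    IsSemialgebraicFunOn ℚ C (cLog e s c κ M i) := by
  by_cases h : e i = 2
  · by_cases hM : M i % 2 = 1
    · have hne : ∀ x ∈ C, κ i x ≠ 0 := fun x hx => (hpos i h x hx).ne'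
      exact (((IsSemialgebraicFunOn.mul_holds (hc i) (isSemialgebraicFunOn_sqTrans hC 1 (M i / 2) (hκ i) hne))).div
        (hκ i) hne).congr fun x _ => by simp [cLog, h, hM]
    · exact (isSemialgebraicFunOn_ratCast hC 0).congr fun x _ => by simp [cLog, h, hM]
  · exact (isSemialgebraicFunOn_logCoef hC s M hc hκ hs i).congr fun x _ => by simp [cLog, h]

/-- Auxiliary step `isSemialgebraicFunOn_atanArg`. [bookkeeping] -/
theorem isSemialgebraicFunOn_atanArg {b q : ℕ} {C : Set (Fin b → ℝ)} (hC : IsSemialgebraic ℚ C) (e : Fin q → ℕ)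
    {κ : Fin q → (Fin b → ℝ) → ℝ} (hκ : ∀ i, IsSemialgebraicFunOn ℚ C (κ i)) (i : Fin q) :
    IsSemialgebraicFunOn ℚ C (atanArg e κ i) := by
  by_cases h : e i = 2
  · exact (IsSemialgebraicFunOn.sqrt_holds (hκ i)).congr fun x _ => by simp [atanArg, h]
  · exact (isSemialgebraicFunOn_ratCast hC 0).congr fun x _ => by simp [atanArg, h]

/-- Auxiliary step `isSemialgebraicFunOn_cAtan`. [bookkeeping] -/
theorem isSemialgebraicFunOn_cAtan {b q : ℕ} {C : Set (Fin b → ℝ)} (hC : IsSemialgebraic ℚ C) (e : Fin q → ℕ)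
    {c κ : Fin q → (Fin b → ℝ) → ℝ} (M : Fin q → ℕ)
    (hc : ∀ i, IsSemialgebraicFunOn ℚ C (c i)) (hκ : ∀ i, IsSemialgebraicFunOn ℚ C (κ i))
    (hpos : ∀ i, e i = 2 → ∀ x ∈ C, 0 < κ i x) (i : Fin q) :
    IsSemialgebraicFunOn ℚ C (cAtan e c κ M i) := by
  by_cases h : e i = 2 ∧ M i % 2 = 0
  · have hne : ∀ x ∈ C, κ i x ≠ 0 := fun x hx => (hpos i h.1 x hx).ne'
    have hsq : ∀ x ∈ C, Real.sqrt (κ i x) ≠ 0 := fun x hx => (Real.sqrt_pos.mpr (hpos i h.1 x hx)).ne'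
    exact ((IsSemialgebraicFunOn.mul_holds (hc i) (isSemialgebraicFunOn_sqTrans hC 0 (M i / 2) (hκ i) hne)).div
      (IsSemialgebraicFunOn.sqrt_holds (hκ i)) hsq).congr fun x _ => by simp [cAtan, h]
  · exact (isSemialgebraicFunOn_ratCast hC 0).congr fun x _ => by simp [cAtan, h]

/-- Auxiliary step `isSemialgebraicFunOn_circRhs`. [bookkeeping] -/
theorem isSemialgebraicFunOn_circRhs {b q : ℕ} {C : Set (Fin b → ℝ)} (hC : IsSemialgebraic ℚ C) (e : Fin q → ℕ)
    (s : Fin q → Bool) {a₀ : (Fin b → ℝ) → ℝ} {c κ : Fin q → (Fin b → ℝ) → ℝ} (M : Fin q → ℕ)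
    (ha₀ : IsSemialgebraicFunOn ℚ C a₀)
    (hc : ∀ i, IsSemialgebraicFunOn ℚ C (c i)) (hκ : ∀ i, IsSemialgebraicFunOn ℚ C (κ i))
    (hs : ∀ i, s i = true → ∀ x ∈ C, κ i x ≠ 0) (hpos : ∀ i, e i = 2 → ∀ x ∈ C, 0 < κ i x) :
    IsSemialgebraicFunOn ℚ C (fun x => -(a₀ x + ∑ i, cPoly e s c κ M i x)) :=
  (IsSemialgebraicFunOn.add_holds ha₀ (KZ.isSemialgebraicFunOn_finset_sum Finset.univ hC fun i _ =>
    isSemialgebraicFunOn_cPoly hC e s M hc hκ hs hpos i)).neg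

/-! ## §3 D8-TOP (circle twin): the residual REDUCED to the per-cell closing statement `CellCloseC` — TYPED and the
reduction `cylKernelZeroCirclePos_of_cellCloseC` PROVED (smooth sub-base, sign cells, a.e. ⇒ pointwise, restriction,
domain additivity: the landed §3ac argument verbatim with the kernel `θ^{Mᵢ}/(1+θ^{eᵢ}κᵢ)`). -/

end G13
end Summit.KontsevichZagierPeriods.RootDecompRelativeModAbsolute.Rung30571.RegularisedLogLayer.CylLog.Leaf
end
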